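import Mathlib.Analysis.InnerProductSpace.PiL2
import Mathlib.Analysis.Complex.Basic
import Mathlib.LinearAlgebra.Dimension.Finrank
import Mathlib.SetTheory.Cardinal.ENat
import Literature.Analysis.FunctionSpaces.TorusFluidGlue
import HarnessLib

/-!
# The linearised Navier–Stokes operator at a steady state on the flat torus: classical point
spectrum, unstable dimension, centres (Fiedler 1988, §2)

Definitions module (no named facts) for the route `Summits/AnomalousDissipation/…/Theses/HopfSnake`
(item `GlobalHopfAlternativeNS`, the Landau-count and Stokes-curve cards): the data Fiedler's
global Hopf bifurcation theorem reads off the linearisation of a steady state — the **unstable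
dimension** `E` (Fiedler 1988, (2.23): *"the number of eigenvalues of `L(λ)` with positive real
part, counting algebraic multiplicity"*) and the notion of a **centre** (Def. 2.1: *"a stationary
solution … `D_x f(λ₀, x₀)` has some purely imaginary nonzero eigenvalues"*) — for the
incompressible Navier–Stokes system with viscosity `ν` on the flat torus `T^d`
(`UnitAddTorus d`, the accepted torus calculus `Literature.Analysis.FunctionSpaces.Torus.*`).

The linearisation of `∂ₜu + (u·∇)u + ∇p = νΔu + f`, `div u = 0` at a smooth steady state `u_S`
is `L(ν, u_S) w = νΔw − (u_S·∇)w − (w·∇)u_S − ∇q`, `div w = 0` (Constantin–Foias 1988, Ch. 6–7: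
`L = −νA − B(u_S, ·) − B(·, u_S)` with the Stokes operator `A = −PΔ` and `B(u,v) = P(u·∇v)`).
**This file works in the classical (smooth, with-pressure) formulation**, which needs neither the
Leray projector on smooth fields nor unbounded-operator spectral theory: by elliptic regularity
every `L²`-eigenfunction (indeed every generalised eigenfunction) of the closed operator
`−νA − DB(u_S)` on `L²_{σ,0}` is smooth, and `z = P g` for smooth `g` iff `z = g − ∇q` for a smooth
`q` with `div z = 0`, so the classical point spectrum with pressures below IS the point spectrum
of the operator, with the same Jordan chains (this equivalence is a theorem, not vendored here).

## Contents (all on complex-valued fields `w : T^d → ℂ^d`, the complexification)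

* `Torus.divergenceC`, `Torus.IsDivFreeC`, `Torus.gradientC`, `Torus.realToComplex`,
  `Torus.stretch` (`(w·∇)u_S`), `Torus.linConvect` (`DB(u_S) w = (u_S·∇)w + (w·∇)u_S`, the
  derivative of the Navier–Stokes nonlinearity at `u_S`).
* `Torus.linearizedNSOperator ν u_S w q = νΔw − (u_S·∇)w − (w·∇)u_S − ∇q` (**the requested
  notion**, as the classical differential expression on a velocity–pressure pair).
* `Torus.IsSteadyNSState ν f u_S p_S` — `u_S` is a smooth steady classical solution of `NS_ν(f)`
  (the accepted `Torus.IsClassicalNSSolutionOn univ` on constant-in-time data, as the request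
  phrases it).
* `Torus.LinNSResolventRel ν u_S μ w g` — `(L(ν,u_S) − μ) w = g` classically: `w` smooth,
  divergence free, mean zero, and `νΔw − (u_S·∇)w − (w·∇)u_S − ∇q − μ w = g` for a smooth `q`.
* `Torus.IsLinNSEigenvalue ν u_S μ`, `Torus.IsLinNSJordanChain`, `Torus.linNSRootSet`
  (generalised eigenvectors = ends of Jordan chains `(L − μ) c_{j+1} = c_j`, `c₀ = 0`),
  `Torus.linNSRootSpace` (their `ℂ`-span), `Torus.linNSAlgMultiplicity ν u_S μ : ℕ∞` (its
  dimension, `Module.rank … |>.toENat`), `Torus.linNSUnstableDim ν u_S : ℕ∞` (Fiedler's `E`: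
  the supremum over finite sets of eigenvalues with positive real part of the summed algebraic
  multiplicities — a finite number for the genuine operator, compact resolvent; `⊤` only as
  junk), `Torus.IsLinNSCentre ν f u_S p_S` (Fiedler's Def. 2.1 for `NS_ν(f)`).
* Proved API: `linearizedNSOperator_zero`, `linNSResolventRel_zero` (`(L − μ) 0 = 0`),
  `isLinNSJordanChain_zero`, `zero_mem_linNSRootSet`, `exists_chain_succ` (chains may be
  prolonged by a leading zero), `isLinNSEigenvalue_iff_exists_chain_one`,
  `mem_linNSRootSet_of_eigen`, `IsLinNSCentre.exists_eigenvalue`,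
  `linNSAlgMultiplicity_eq_zero_iff`, `isDivFreeC_zero`, `gradientC_zero` (plus private calculus
  trivia: derivatives of constants vanish).

## What is NOT here (of the request), and why

(1) the Stokes operator `A = −PΔ`, the Leray projector and the energy space exist already
(`Torus.stokesOperator`, `Torus.lerayProjector`, `Torus.energySpace` of `StokesTorus` /
`LerayProjector` / `EnergySpaceTorus`); fractional powers `A^ω`, `X^ω = D(A^ω)` are not defined
(no functional calculus for `LinearPMap` in the tree). (2) `B(u,v) = P(u·∇v)` as an `L²`-valued
bilinear map is not defined here (it is `lerayProjector` of the `L²` class of `Torus.convect u v`;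
the classical `DB(u_S)` is `linConvect`). (3) "closed densely defined with compact resolvent" is a
theorem about the `L²` realisation, not part of a definition. (4) the net crossing number `χ` and
the centre index `(−1)^{E⁰} χ` along a `C¹` branch (Fiedler (2.24)–(2.26)) are phrased through
`E` along the branch by the consumer, as the request allows ("χ can then be phrased through `E`").

## Design notes

* Complex fields are `UnitAddTorus d → EuclideanSpace ℂ d`, a real normed space, so the accepted
  `Torus.laplacian`, `Torus.convect`, `Torus.partialDeriv`, `Torus.IsSmooth`, `Torus.HasZeroMean`
  apply verbatim; only the divergence, the pressure gradient and the stretching term `(w·∇)u_S`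
  need complex-coefficient copies (`divergenceC`, `gradientC`, `stretch`).
* Generalised eigenvectors through Jordan chains rather than powers `(L − μ)^k` (which would need
  the projector): `w ∈ linNSRootSet` iff some chain `0 = c₀, (L − μ)c₁ = c₀, …, (L − μ)c_k = c_{k−1}`
  ends at `c_k = w`. The root SET is in truth a subspace; we take its span (`linNSRootSpace`) so
  that no linearity proof is load-bearing for the definition, and measure it by `Module.rank`
  (`Cardinal.toENat`), which is the algebraic multiplicity when finite.
* `E` as `ℕ∞` via `⨆` over finite sets of unstable eigenvalues (no topology on `ℕ∞` needed); the
  consumer takes `.toNat` where Fiedler's finiteness (compact resolvent, sectoriality) is known.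
* Mathlib (grepped): `EuclideanSpace`, `WithLp.toLp`, `Module.rank`, `Cardinal.toENat`,
  `Submodule.span`; Mathlib has no Navier–Stokes linearisation, no Stokes operator.

## References

* B. Fiedler, *Global Bifurcation of Periodic Solutions with Symmetry*, Lecture Notes in Math.
  1309, Springer (1988), §2.1 Def. 2.1 (centres), §2.5 (2.23)–(2.26) (unstable dimension, net
  crossing number, centre index). [Fiedler1988]
* P. Constantin, C. Foias, *Navier–Stokes Equations*, Univ. Chicago Press (1988), Ch. 4 (Stokes
  operator), Ch. 6–7 (the bilinear form `B` and linearisation). [ConstantinFoias1988]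
* R. Temam, *Navier–Stokes Equations*, North-Holland (1977/1979), Ch. I–II. [Temam1979]
-/

noncomputable section

open scoped BigOperators

namespace Literature.Analysis.FluidPDE

namespace Torus

open Literature.Analysis.FunctionSpaces

variable {d : Type*} [Fintype d] [DecidableEq d]

/-! ### Complex-coefficient copies of the torus calculus -/

/-- A real vector of `ℝ^d` viewed in `ℂ^d` (coordinatewise `Complex.ofReal`). [folklore] -/
def realToComplex (v : EuclideanSpace ℝ d) : EuclideanSpace ℂ d :=
  WithLp.toLp 2 fun i => ((v i : ℝ) : ℂ)

omit [Fintype d] [DecidableEq d] in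
/-- `realToComplex v i = v i`. [folklore] -/
@[simp] theorem realToComplex_apply (v : EuclideanSpace ℝ d) (i : d) :
    realToComplex v i = ((v i : ℝ) : ℂ) := rfl

omit [Fintype d] [DecidableEq d] in
/-- `realToComplex 0 = 0`. [folklore] -/
@[simp] theorem realToComplex_zero : realToComplex (0 : EuclideanSpace ℝ d) = 0 := by
  ext i; simp

/-- The divergence `div w = ∑ᵢ ∂ᵢ wᵢ` of a complex vector field on `T^d` (the accepted
`Torus.divergence`, complex coefficients). [folklore] -/
def divergenceC (w : UnitAddTorus d → EuclideanSpace ℂ d) (x : UnitAddTorus d) : ℂ :=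
  ∑ i, FunctionSpaces.Torus.partialDeriv i (fun y => w y i) x

/-- A complex vector field on `T^d` is divergence free. [folklore] -/
def IsDivFreeC (w : UnitAddTorus d → EuclideanSpace ℂ d) : Prop :=
  ∀ x, divergenceC w x = 0

/-- The gradient `∇q = (∂ᵢ q)ᵢ ∈ ℂ^d` of a complex scalar function on `T^d` (the pressure
gradient of the complexified linearisation). [folklore] -/
def gradientC (q : UnitAddTorus d → ℂ) (x : UnitAddTorus d) : EuclideanSpace ℂ d :=
  WithLp.toLp 2 fun i => FunctionSpaces.Torus.partialDeriv i q x

/-- The **stretching term** `((w·∇)u)(x) = ∑ⱼ wⱼ(x) ∂ⱼu(x) ∈ ℂ^d` of a complex field `w` against a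
real field `u` (the second half of the derivative of the Navier–Stokes nonlinearity;
Constantin–Foias 1988, Ch. 6, `B(w, u)` before projection). [cite: ConstantinFoias1988, Ch. 6] -/
def stretch (w : UnitAddTorus d → EuclideanSpace ℂ d) (u : UnitAddTorus d → EuclideanSpace ℝ d)
    (x : UnitAddTorus d) : EuclideanSpace ℂ d :=
  ∑ j, w x j • realToComplex (FunctionSpaces.Torus.partialDeriv j u x)

/-- **The derivative of the Navier–Stokes nonlinearity at `u_S`** (before projection):
`DB(u_S) w = (u_S·∇)w + (w·∇)u_S` (Constantin–Foias 1988, Ch. 6–7; `Torus.convect` is the accepted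
convective derivative). [cite: ConstantinFoias1988, Ch. 6] -/
def linConvect (uS : UnitAddTorus d → EuclideanSpace ℝ d) (w : UnitAddTorus d → EuclideanSpace ℂ d)
    (x : UnitAddTorus d) : EuclideanSpace ℂ d :=
  FunctionSpaces.Torus.convect uS w x + stretch w uS x

/-! ### The linearised operator, steady states, resolvent relation -/

/-- **The linearised Navier–Stokes operator at the steady state `u_S` with viscosity `ν`**, as
the classical differential expression on a (complex) velocity–pressure pair:
`L(ν, u_S)(w, q)(x) = νΔw(x) − (u_S·∇)w(x) − (w·∇)u_S(x) − ∇q(x)` — the linearisation of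
`∂ₜu = νΔu − (u·∇)u − ∇p + f` at `u = u_S` (Constantin–Foias 1988, Ch. 7: `−νA − B(u_S,·) −
B(·,u_S)` after Leray projection; the pressure gradient replaces the projection in the classical
formulation, see the module docstring). [cite: ConstantinFoias1988, Ch. 7] -/
def linearizedNSOperator (ν : ℝ) (uS : UnitAddTorus d → EuclideanSpace ℝ d)
    (w : UnitAddTorus d → EuclideanSpace ℂ d) (q : UnitAddTorus d → ℂ) (x : UnitAddTorus d) :
    EuclideanSpace ℂ d :=
  ν • FunctionSpaces.Torus.laplacian w x - linConvect uS w x - gradientC q x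

/-- Unfolding `linearizedNSOperator`. [folklore] -/
theorem linearizedNSOperator_apply (ν : ℝ) (uS : UnitAddTorus d → EuclideanSpace ℝ d)
    (w : UnitAddTorus d → EuclideanSpace ℂ d) (q : UnitAddTorus d → ℂ) (x : UnitAddTorus d) :
    linearizedNSOperator ν uS w q x =
      ν • FunctionSpaces.Torus.laplacian w x - (FunctionSpaces.Torus.convect uS w x + stretch w uS x) -
        gradientC q x := rfl

/-- **`u_S` is a smooth steady state of `NS_ν(f)` with pressure `p_S`**: a classical solution of
the forced incompressible Navier–Stokes system on `T^d × ℝ` which is constant in time (the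
accepted `Torus.IsClassicalNSSolutionOn univ` on constant data, as the route request phrases
it); equivalently `(u_S·∇)u_S = νΔu_S − ∇p_S + f`, `div u_S = 0`, `u_S`, `p_S` smooth. [folklore] -/
def IsSteadyNSState (ν : ℝ) (f uS : UnitAddTorus d → EuclideanSpace ℝ d)
    (pS : UnitAddTorus d → ℝ) : Prop :=
  FunctionSpaces.Torus.IsClassicalNSSolutionOn Set.univ ν (fun _ => f) (fun _ => uS) (fun _ => pS)

/-- **The resolvent relation `(L(ν, u_S) − μ) w = g`, classically**: `w` is a smooth,
divergence-free, mean-zero complex field and for some smooth complex pressure `q`,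
`νΔw − (u_S·∇)w − (w·∇)u_S − ∇q − μ w = g` pointwise on `T^d`. With `g = 0`: `(μ, w)` is an
eigenpair; with `g` the previous chain element: a Jordan chain step. (Fiedler 1988, §2: the
eigenvalue problem of the linearisation `D_x f(λ₀, x₀)`; Constantin–Foias 1988, Ch. 7.)
[cite: Fiedler1988, §2.1 Def. 2.1 and §2.5 (2.23)] -/
def LinNSResolventRel (ν : ℝ) (uS : UnitAddTorus d → EuclideanSpace ℝ d) (μ : ℂ)
    (w g : UnitAddTorus d → EuclideanSpace ℂ d) : Prop :=
  FunctionSpaces.Torus.IsSmooth w ∧ IsDivFreeC w ∧ FunctionSpaces.Torus.HasZeroMean w ∧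
    ∃ q : UnitAddTorus d → ℂ, FunctionSpaces.Torus.IsSmooth q ∧
      ∀ x, linearizedNSOperator ν uS w q x - μ • w x = g x

/-- **`μ ∈ ℂ` is an eigenvalue of the linearisation `L(ν, u_S)`** (point spectrum of the
complexification): there is a non-zero smooth divergence-free mean-zero `w` and a smooth `q` with
`νΔw − (u_S·∇)w − (w·∇)u_S − ∇q = μ w`. [cite: Fiedler1988, §2.5 (2.23)] -/
def IsLinNSEigenvalue (ν : ℝ) (uS : UnitAddTorus d → EuclideanSpace ℝ d) (μ : ℂ) : Prop :=
  ∃ w : UnitAddTorus d → EuclideanSpace ℂ d, w ≠ 0 ∧ LinNSResolventRel ν uS μ w 0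

/-! ### Jordan chains, generalised eigenvectors, algebraic multiplicity -/

/-- **A Jordan chain of length `k` of `L(ν, u_S)` at `μ`**: fields `c 0 = 0` and
`(L − μ) c (j+1) = c j` for `j < k` (so `c 1` is an eigenvector or zero, and `c k` is a generalised
eigenvector of order `≤ k`); values of `c` beyond `k` are irrelevant. Algebraic multiplicities are
counted through such chains (Fiedler 1988, (2.23): "counting algebraic multiplicity").
[cite: Fiedler1988, §2.5 (2.23)] -/
def IsLinNSJordanChain (ν : ℝ) (uS : UnitAddTorus d → EuclideanSpace ℝ d) (μ : ℂ) (k : ℕ)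
    (c : ℕ → UnitAddTorus d → EuclideanSpace ℂ d) : Prop :=
  c 0 = 0 ∧ ∀ j < k, LinNSResolventRel ν uS μ (c (j + 1)) (c j)

/-- **The generalised eigenvectors (root vectors) of `L(ν, u_S)` at `μ`**: the ends `c k` of
Jordan chains of any length `k`. [cite: Fiedler1988, §2.5 (2.23)] -/
def linNSRootSet (ν : ℝ) (uS : UnitAddTorus d → EuclideanSpace ℝ d) (μ : ℂ) :
    Set (UnitAddTorus d → EuclideanSpace ℂ d) :=
  {w | ∃ (k : ℕ) (c : ℕ → UnitAddTorus d → EuclideanSpace ℂ d), IsLinNSJordanChain ν uS μ k c ∧ c k = w}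

/-- **The root subspace (generalised eigenspace) of `L(ν, u_S)` at `μ`**: the `ℂ`-span of the
root vectors (which in truth already form a subspace). [cite: Fiedler1988, §2.5 (2.23)] -/
def linNSRootSpace (ν : ℝ) (uS : UnitAddTorus d → EuclideanSpace ℝ d) (μ : ℂ) :
    Submodule ℂ (UnitAddTorus d → EuclideanSpace ℂ d) :=
  Submodule.span ℂ (linNSRootSet ν uS μ)

/-- **The algebraic multiplicity of `μ` as an eigenvalue of `L(ν, u_S)`**: the dimension of the
root subspace, in `ℕ∞` (`Module.rank`, `Cardinal.toENat`; `0` iff `μ` is not an eigenvalue, finite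
for the genuine operator). [cite: Fiedler1988, §2.5 (2.23)] -/
def linNSAlgMultiplicity (ν : ℝ) (uS : UnitAddTorus d → EuclideanSpace ℝ d) (μ : ℂ) : ℕ∞ :=
  Cardinal.toENat (Module.rank ℂ (linNSRootSpace ν uS μ))

/-- **Fiedler's unstable dimension `E(ν, u_S)`** (1988, (2.23): *"the number of eigenvalues of
`L(λ)` with positive real part, counting algebraic multiplicity"*), for the linearised
Navier–Stokes operator at the steady state `u_S`: the supremum over finite sets `s` of complex
numbers with positive real part of `∑_{μ ∈ s} (algebraic multiplicity of μ)`, in `ℕ∞` (finite for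
the genuine operator, which has compact resolvent and is sectorial; non-eigenvalues contribute
`0`). [cite: Fiedler1988, §2.5 (2.23)] -/
def linNSUnstableDim (ν : ℝ) (uS : UnitAddTorus d → EuclideanSpace ℝ d) : ℕ∞ :=
  ⨆ (s : Finset ℂ) (_ : ∀ μ ∈ s, 0 < μ.re), ∑ μ ∈ s, linNSAlgMultiplicity ν uS μ

/-- **A centre of `NS_ν(f)`** (Fiedler 1988, Def. 2.1: *"a stationary solution … `D_x f(λ₀, x₀)`
has some purely imaginary nonzero eigenvalues"*): a smooth steady state `u_S` (pressure `p_S`)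
of `NS_ν(f)` whose linearisation `L(ν, u_S)` has an eigenvalue on `iℝ ∖ {0}`.
[cite: Fiedler1988, §2.1 Def. 2.1] -/
def IsLinNSCentre (ν : ℝ) (f uS : UnitAddTorus d → EuclideanSpace ℝ d) (pS : UnitAddTorus d → ℝ) :
    Prop :=
  IsSteadyNSState ν f uS pS ∧ ∃ μ : ℂ, IsLinNSEigenvalue ν uS μ ∧ μ.re = 0 ∧ μ ≠ 0

/-! ### Basic API -/

section API

variable (ν : ℝ) (uS : UnitAddTorus d → EuclideanSpace ℝ d) (μ : ℂ)

omit [DecidableEq d] in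
/-- The zero complex field is smooth (constant lift). [folklore] -/
private theorem isSmooth_zero_field_aux :
    FunctionSpaces.Torus.IsSmooth (0 : UnitAddTorus d → EuclideanSpace ℂ d) := by
  change ContDiff ℝ _ (FunctionSpaces.Torus.lift (0 : UnitAddTorus d → EuclideanSpace ℂ d))
  have : FunctionSpaces.Torus.lift (0 : UnitAddTorus d → EuclideanSpace ℂ d) = 0 := rfl
  rw [this]
  exact contDiff_const

omit [DecidableEq d] in
/-- The zero complex scalar is smooth. [folklore] -/
private theorem isSmooth_zero_scalar_aux : FunctionSpaces.Torus.IsSmooth (0 : UnitAddTorus d → ℂ) := by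
  change ContDiff ℝ _ (FunctionSpaces.Torus.lift (0 : UnitAddTorus d → ℂ))
  have : FunctionSpaces.Torus.lift (0 : UnitAddTorus d → ℂ) = 0 := rfl
  rw [this]
  exact contDiff_const

omit [Fintype d] [DecidableEq d] in
/-- The torus Fréchet derivative of a constant field vanishes. [folklore] -/
private theorem fderiv_const_field_aux {F : Type*} [NormedAddCommGroup F] [NormedSpace ℝ F] (c : F)
    (x : UnitAddTorus d) : FunctionSpaces.Torus.fderiv (fun _ : UnitAddTorus d => c) x = 0 := by
  change _root_.fderiv ℝ (FunctionSpaces.Torus.liftAt (fun _ : UnitAddTorus d => c) x) 0 = 0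
  have : FunctionSpaces.Torus.liftAt (fun _ : UnitAddTorus d => c) x = fun _ => c := rfl
  rw [this]
  simp

omit [Fintype d] in
/-- The torus partial derivatives of a constant vanish. [folklore] -/
private theorem partialDeriv_const_aux {F : Type*} [NormedAddCommGroup F] [NormedSpace ℝ F] (c : F) (i : d)
    (x : UnitAddTorus d) : FunctionSpaces.Torus.partialDeriv i (fun _ : UnitAddTorus d => c) x = 0 := by
  change deriv (fun t : ℝ => c) 0 = 0
  simp

omit [DecidableEq d] in
/-- The torus Laplacian of a constant field vanishes. [folklore] -/
private theorem laplacian_const_field_aux {F : Type*} [NormedAddCommGroup F] [NormedSpace ℝ F] (c : F)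
    (x : UnitAddTorus d) : FunctionSpaces.Torus.laplacian (fun _ : UnitAddTorus d => c) x = 0 := by
  unfold FunctionSpaces.Torus.laplacian
  have : FunctionSpaces.Torus.liftAt (fun _ : UnitAddTorus d => c) x = fun _ => c := rfl
  rw [this, InnerProductSpace.laplacian_eq_iteratedFDeriv_stdOrthonormalBasis]
  simp [iteratedFDeriv_const_of_ne (𝕜 := ℝ) (n := 2) (by norm_num) c]

omit [DecidableEq d] in
/-- The zero field has zero mean. [folklore] -/
private theorem hasZeroMean_zero_field_aux :
    FunctionSpaces.Torus.HasZeroMean (0 : UnitAddTorus d → EuclideanSpace ℂ d) := by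
  simp [FunctionSpaces.Torus.HasZeroMean]

/-- The zero field is divergence free. [folklore] -/
theorem isDivFreeC_zero : IsDivFreeC (0 : UnitAddTorus d → EuclideanSpace ℂ d) := by
  intro x
  simp only [divergenceC, Pi.zero_apply]
  exact Finset.sum_eq_zero fun i _ => by
    simpa using partialDeriv_const_aux (d := d) (0 : ℂ) i x

omit [Fintype d] in
/-- `∇0 = 0`. [folklore] -/
theorem gradientC_zero (x : UnitAddTorus d) : gradientC (0 : UnitAddTorus d → ℂ) x = 0 := by
  ext i
  simp only [gradientC, PiLp.toLp_apply, PiLp.zero_apply]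
  exact partialDeriv_const_aux (0 : ℂ) i x

/-- The linearised operator kills the zero pair: `L(ν,u_S)(0, 0) = 0`. [folklore] -/
theorem linearizedNSOperator_zero (x : UnitAddTorus d) :
    linearizedNSOperator ν uS 0 0 x = 0 := by
  rw [linearizedNSOperator]
  have h1 : FunctionSpaces.Torus.laplacian (0 : UnitAddTorus d → EuclideanSpace ℂ d) x = 0 :=
    laplacian_const_field_aux (0 : EuclideanSpace ℂ d) x
  have h2 : linConvect uS (0 : UnitAddTorus d → EuclideanSpace ℂ d) x = 0 := by
    simp only [linConvect, FunctionSpaces.Torus.convect, stretch, Pi.zero_apply, PiLp.zero_apply,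
      zero_smul, Finset.sum_const_zero, add_zero]
    rw [show (0 : UnitAddTorus d → EuclideanSpace ℂ d) = fun _ => 0 from rfl, fderiv_const_field_aux]
    simp
  rw [h1, h2, gradientC_zero, smul_zero, sub_zero, sub_zero]

/-- `(L(ν,u_S) − μ) 0 = 0`: the trivial resolvent relation (pressure `q = 0`). [folklore] -/
theorem linNSResolventRel_zero : LinNSResolventRel ν uS μ 0 0 := by
  refine ⟨isSmooth_zero_field_aux, isDivFreeC_zero, hasZeroMean_zero_field_aux, 0, isSmooth_zero_scalar_aux,
    fun x => ?_⟩
  rw [linearizedNSOperator_zero]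
  simp

/-- The constant-zero sequence is a Jordan chain of every length. [folklore] -/
theorem isLinNSJordanChain_zero (k : ℕ) : IsLinNSJordanChain ν uS μ k (fun _ => 0) :=
  ⟨rfl, fun _ _ => linNSResolventRel_zero ν uS μ⟩

/-- `0` is a root vector (of every eigenvalue candidate). [folklore] -/
theorem zero_mem_linNSRootSet : (0 : UnitAddTorus d → EuclideanSpace ℂ d) ∈ linNSRootSet ν uS μ :=
  ⟨0, fun _ => 0, isLinNSJordanChain_zero ν uS μ 0, rfl⟩

/-- **Prolonging a chain by zeros**: a root vector of order `≤ k` is one of order `≤ k + 1`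
(prefix the chain with one more `0`). [folklore] -/
theorem exists_chain_succ {k : ℕ} {c : ℕ → UnitAddTorus d → EuclideanSpace ℂ d}
    (hc : IsLinNSJordanChain ν uS μ k c) :
    IsLinNSJordanChain ν uS μ (k + 1) (fun j => Nat.casesOn j 0 c) ∧
      (fun j => (Nat.casesOn j 0 c : UnitAddTorus d → EuclideanSpace ℂ d)) (k + 1) = c k := by
  refine ⟨⟨rfl, fun j hj => ?_⟩, rfl⟩
  rcases j with _ | j
  · -- the new first step `(L − μ) (c 0) = 0` with `c 0 = 0`
    change LinNSResolventRel ν uS μ (c 0) 0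
    rw [hc.1]
    exact linNSResolventRel_zero ν uS μ
  · change LinNSResolventRel ν uS μ (c (j + 1)) (c j)
    exact hc.2 j (by omega)

/-- Eigenvalues are exactly the `μ` with a non-zero root vector of order `1` (chains `0, w` with
`(L − μ) w = 0`). [folklore] -/
theorem isLinNSEigenvalue_iff_exists_chain_one :
    IsLinNSEigenvalue ν uS μ ↔
      ∃ w : UnitAddTorus d → EuclideanSpace ℂ d, w ≠ 0 ∧
        ∃ c : ℕ → UnitAddTorus d → EuclideanSpace ℂ d, IsLinNSJordanChain ν uS μ 1 c ∧ c 1 = w := by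
  constructor
  · rintro ⟨w, hw, hrel⟩
    refine ⟨w, hw, fun j => Nat.casesOn j 0 fun _ => w, ⟨rfl, fun j hj => ?_⟩, rfl⟩
    have hj0 : j = 0 := by omega
    subst hj0
    exact hrel
  · rintro ⟨w, hw, c, ⟨h0, hstep⟩, rfl⟩
    refine ⟨c 1, hw, ?_⟩
    have := hstep 0 (by omega)
    rwa [h0] at this

/-- An eigenvector is a root vector. [folklore] -/
theorem mem_linNSRootSet_of_eigen {w : UnitAddTorus d → EuclideanSpace ℂ d}
    (h : LinNSResolventRel ν uS μ w 0) : w ∈ linNSRootSet ν uS μ := by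
  refine ⟨1, fun j => Nat.casesOn j 0 fun _ => w, ⟨rfl, fun j hj => ?_⟩, rfl⟩
  have hj0 : j = 0 := by omega
  subst hj0
  exact h

/-- A centre is in particular a steady state with a purely imaginary non-zero eigenvalue
(unfolding). [cite: Fiedler1988, §2.1 Def. 2.1] -/
theorem IsLinNSCentre.exists_eigenvalue {f : UnitAddTorus d → EuclideanSpace ℝ d}
    {pS : UnitAddTorus d → ℝ} (h : IsLinNSCentre ν f uS pS) :
    ∃ μ : ℂ, IsLinNSEigenvalue ν uS μ ∧ μ.re = 0 ∧ μ ≠ 0 :=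
  h.2

/-- The algebraic multiplicity vanishes iff the root subspace is trivial (`Module.rank` zero).
[folklore] -/
theorem linNSAlgMultiplicity_eq_zero_iff :
    linNSAlgMultiplicity ν uS μ = 0 ↔ linNSRootSpace ν uS μ = ⊥ := by
  rw [linNSAlgMultiplicity, Cardinal.toENat_eq_zero, Submodule.rank_eq_zero]

end API

end Torus

end Literature.Analysis.FluidPDE
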